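import Summits.Ventures.HodgeRepro2.T5SU11OneParameter

/-!
# The unipotent subgroup `N = {n_t}` of `SU(1,1)`: a closed, non-compact, proper one-parameter subgroup

`n_t = su11 (1 + i t) (-i t) = !![1 + i t, -i t; i t, 1 - i t]` is the image under the Cayley transform of
the upper unipotent subgroup `!![1, t; 0, 1]` of `SL₂(ℝ)` (it fixes the boundary point `1` of the disc):
`n_{s+t} = n_s n_t`, `n_0 = 1`, `n_{-t} = n_t⁻¹` (`unip_add`, `unip_zero`, `unip_neg`). As for the
hyperbolic subgroup of `T5SU11HyperbolicSubgroup`, `t ↦ n_t` is CONTINUOUS and PROPER —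
`|a(n_t)| = √(1 + t²) ≥ |t|` (`norm_mat_unip`, `tendsto_unip_cocompact`, `isProperMap_unip`) — so its
range `unipSubgroup ≤ SU(1,1)` is a CLOSED NON-COMPACT subgroup (`isClosed_unipSubgroup`,
`noncompactSpace_unipSubgroup`): the `N` of the Iwasawa decomposition `G = K A N`, beside `K = rot`
and `A = hypSubgroup`. Nothing is claimed about (N).

Blind lane: Mathlib + the HodgeRepro2 prefix only; no sorry; axioms ⊆ {propext, Classical.choice,
Quot.sound}.
-/

namespace Summit.Ventures.HodgeRepro2.T5SU11UnipotentSubgroup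

open Metric Filter Topology Set
open T5UnitaryBound T5PoincareDensity T5PoincareInvariance T5SU11Unimodular T5SU11Fibration
  T5SU11Cartan T5SU11OneParameter T5BergmanCoefficient

/-! ### The elements `n_t` -/

/-- `|1 + i t|² - |i t|² = 1`. -/
lemma normSq_one_add_mul_I_sub (t : ℝ) :
    Complex.normSq (1 + (t : ℂ) * Complex.I) - Complex.normSq (-((t : ℂ) * Complex.I)) = 1 := by
  simp [Complex.normSq_apply]

/-- The unipotent element `n_t = su11 (1 + i t) (-i t) ∈ SU(1,1)`. -/
noncomputable def unip (t : ℝ) : SU11 :=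
  toSU11 (1 + (t : ℂ) * Complex.I) (-((t : ℂ) * Complex.I)) (normSq_one_add_mul_I_sub t)

/-- The matrix of `n_t`. -/
lemma mat_unip (t : ℝ) : mat (unip t) = su11 (1 + (t : ℂ) * Complex.I) (-((t : ℂ) * Complex.I)) := rfl

/-- `a(n_t) = 1 + i t`. -/
lemma mat_unip_zero_zero (t : ℝ) : mat (unip t) 0 0 = 1 + (t : ℂ) * Complex.I := rfl

/-- `b(n_t) = -i t`. -/
lemma mat_unip_zero_one (t : ℝ) : mat (unip t) 0 1 = -((t : ℂ) * Complex.I) := rfl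

/-- The matrix of `n_t⁻¹`: `su11 (1 - i t) (i t)`. -/
lemma mat_unip_inv (t : ℝ) :
    mat (unip t)⁻¹ = su11 (1 - (t : ℂ) * Complex.I) ((t : ℂ) * Complex.I) := by
  rw [mat_inv, mat_unip_zero_zero, mat_unip_zero_one, neg_neg, map_add, map_one, map_mul,
    Complex.conj_ofReal, Complex.conj_I]
  ring_nf

/-! ### A one-parameter subgroup -/

/-- **`n_{s+t} = n_s n_t`**. -/
theorem unip_add (s t : ℝ) : unip (s + t) = unip s * unip t := by
  apply ext_mat
  rw [mat_mul, mat_unip, mat_unip, mat_unip, su11_mul]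
  simp only [map_neg, map_mul, map_add, map_one, Complex.conj_ofReal, Complex.conj_I]
  congr 1
  · push_cast
    ring_nf
  · push_cast
    ring_nf

/-- `n_0 = 1`. -/
theorem unip_zero : unip 0 = 1 := by
  apply ext_mat
  rw [mat_unip]
  show su11 (1 + ((0 : ℝ) : ℂ) * Complex.I) (-(((0 : ℝ) : ℂ) * Complex.I)) =
    ((((1 : SU11) : Matrix.SpecialLinearGroup (Fin 2) ℂ)) : Matrix (Fin 2) (Fin 2) ℂ)
  rw [Subgroup.coe_one, Matrix.SpecialLinearGroup.coe_one]
  ext i j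
  fin_cases i <;> fin_cases j <;> simp [su11]

/-- `n_{-t} = n_t⁻¹`. -/
theorem unip_neg (t : ℝ) : unip (-t) = (unip t)⁻¹ := by
  apply ext_mat
  rw [mat_unip_inv, mat_unip]
  push_cast
  ring_nf

/-! ### Continuity and properness -/

/-- `t ↦ su11 (1 + i t) (-i t)` is continuous into `M₂(ℂ)`. -/
lemma continuous_su11_unip :
    Continuous fun t : ℝ => su11 (1 + (t : ℂ) * Complex.I) (-((t : ℂ) * Complex.I)) := by
  refine continuous_pi fun i => continuous_pi fun j => ?_
  fin_cases i <;> fin_cases j <;> simp only [su11] <;> simp <;> fun_prop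

/-- **`t ↦ n_t` is continuous.** -/
theorem continuous_unip : Continuous unip :=
  (continuous_su11_unip.subtype_mk fun t =>
      (su11_memU11_det_one _ _ (normSq_one_add_mul_I_sub t)).2).subtype_mk
    fun t => (mem_SU11_iff _).mpr (su11_memU11_det_one _ _ (normSq_one_add_mul_I_sub t)).1

/-- `|a(n_t)| = √(1 + t²)`. -/
lemma norm_mat_unip (t : ℝ) : ‖mat (unip t) 0 0‖ = Real.sqrt (1 + t ^ 2) := by
  rw [mat_unip_zero_zero, show (1 : ℂ) + (t : ℂ) * Complex.I = ((1 : ℝ) : ℂ) + (t : ℂ) * Complex.I by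
    push_cast; rfl, Complex.norm_add_mul_I, one_pow]

/-- `|t| ≤ |a(n_t)|`. -/
lemma abs_le_norm_mat_unip (t : ℝ) : |t| ≤ ‖mat (unip t) 0 0‖ := by
  have h := Complex.abs_im_le_norm (1 + (t : ℂ) * Complex.I)
  rw [mat_unip_zero_zero]
  simpa using h

/-- `g ↦ a(g)` is continuous on `SU(1,1)`. -/
lemma continuous_mat_zero_zero : Continuous fun g : SU11 => mat g 0 0 :=
  (continuous_apply 0).comp ((continuous_apply 0).comp
    (continuous_subtype_val.comp continuous_subtype_val))

/-- **`t ↦ n_t` is proper**: it carries the cocompact filter of `ℝ` to that of `SU(1,1)`. -/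
theorem tendsto_unip_cocompact : Tendsto unip (cocompact ℝ) (cocompact SU11) := by
  rw [Filter.hasBasis_cocompact.tendsto_right_iff]
  intro K hK
  obtain ⟨B, hB⟩ := hK.bddAbove_image (continuous_norm.comp continuous_mat_zero_zero).continuousOn
  rw [Filter.eventually_iff, Filter.mem_cocompact]
  refine ⟨Icc (-B) B, isCompact_Icc, fun t ht hmem => ?_⟩
  have h1 : ‖mat (unip t) 0 0‖ ≤ B := hB ⟨unip t, hmem, rfl⟩
  have h2 : |t| ≤ B := (abs_le_norm_mat_unip t).trans h1
  exact ht (abs_le.1 h2)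

/-- `t ↦ n_t` is a proper map. -/
theorem isProperMap_unip : IsProperMap unip :=
  isProperMap_iff_tendsto_cocompact.2 ⟨continuous_unip, tendsto_unip_cocompact⟩

/-- `t ↦ n_t` is injective. -/
theorem unip_injective : Function.Injective unip := by
  intro s t h
  have h1 : mat (unip s) 0 1 = mat (unip t) 0 1 := by rw [h]
  rw [mat_unip_zero_one, mat_unip_zero_one, neg_inj,
    mul_left_inj' Complex.I_ne_zero, Complex.ofReal_inj] at h1
  exact h1

/-- `t ↦ n_t` is a closed embedding. -/
theorem isClosedEmbedding_unip : Topology.IsClosedEmbedding unip :=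
  Topology.IsClosedEmbedding.of_continuous_injective_isClosedMap continuous_unip unip_injective
    isProperMap_unip.isClosedMap

/-! ### The unipotent subgroup -/

/-- **The unipotent subgroup** `N = {n_t : t ∈ ℝ} ≤ SU(1,1)`. -/
def unipSubgroup : Subgroup SU11 where
  carrier := Set.range unip
  mul_mem' := by
    rintro _ _ ⟨s, rfl⟩ ⟨t, rfl⟩
    exact ⟨s + t, unip_add s t⟩
  one_mem' := ⟨0, unip_zero⟩
  inv_mem' := by
    rintro _ ⟨t, rfl⟩
    exact ⟨-t, unip_neg t⟩

/-- `g ∈ N` iff `g = n_t` for some `t`. -/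
lemma mem_unipSubgroup_iff (g : SU11) : g ∈ unipSubgroup ↔ ∃ t, unip t = g := Iff.rfl

/-- `n_t ∈ N`. -/
lemma unip_mem_unipSubgroup (t : ℝ) : unip t ∈ unipSubgroup := ⟨t, rfl⟩

/-- `N = range n` as a set. -/
lemma coe_unipSubgroup : (unipSubgroup : Set SU11) = Set.range unip := rfl

/-- **`N` is closed in `SU(1,1)`** (the range of a proper map). -/
theorem isClosed_unipSubgroup : IsClosed (unipSubgroup : Set SU11) :=
  isProperMap_unip.isClosed_range

/-- **`N` is not compact**: `|a(n_t)| = √(1 + t²)` is unbounded on it. -/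
instance noncompactSpace_unipSubgroup : NoncompactSpace unipSubgroup := by
  refine ⟨fun hc => ?_⟩
  have hK : IsCompact (Set.range unip) := by
    have := hc.image continuous_subtype_val
    rwa [Set.image_univ, Subtype.range_coe, coe_unipSubgroup] at this
  obtain ⟨t, ht⟩ := (tendsto_unip_cocompact.eventually hK.compl_mem_cocompact).exists
  exact ht ⟨t, rfl⟩

/-- `N` is a closed non-compact subgroup (both facts in one statement). -/
theorem isClosed_and_noncompact_unipSubgroup :
    IsClosed (unipSubgroup : Set SU11) ∧ NoncompactSpace unipSubgroup :=
  ⟨isClosed_unipSubgroup, inferInstance⟩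

end Summit.Ventures.HodgeRepro2.T5SU11UnipotentSubgroup
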